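import Mathlib
import Summits.NavierStokesRegularity.NavierStokesRegularity.Theorems.TaoLadderRungTwoFlatHopTubeWith
import Summits.NavierStokesRegularity.NavierStokesRegularity.Theorems.TaoLadderRungTwoFlatEnergyFluxPointwise
import HarnessLib

/-!
# AHEAD-TAIL-62 — the TAIL-ENERGY INDUCTION that delivers the tail input (T1) `AheadTailWith` of the core contract
  (design, theory-1 g48; cell harvest/h2-tao-ladder, LADDER §62 (62.11/62.12), referee A-115 (ii); K_A♭ parent item
  stmt-NavierStokesRegularity-22987, route TaoLadderRungTwoFlat)

(T1) = a gauge bound `ω_k·|S i (1+k) t| ≤ BT` for the new-frame shells `k > k_A` beyond the certificate window, at good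
times of hop `n`.  The landed ahead lemma `GappedFrontRobustOn.pseudoFlowOnShift_ahead_tail` cannot supply it: its
hypothesis `hZlow` admits only envelopes `Z_k ≥ Z_min·(1+ε₀)^{−8k}` (the format a-priori decay), which excludes the
`4^{−k}` decay a `k`-uniform gauge bound needs (and the Gaussian tube weight).  This module types the replacement:

* `AheadCutBoundWith … n j G` — an envelope `|S i m t| ≤ 2G` of the flow beyond the CUT at old shell `j` (all `m > j`),
  along the whole hop window `t ∈ [0, c₀]`, for every premise flow of hop `n`;
* `aheadTail_of_cuts` — cuts `j = k_A+1, k_A+2, …` with `ω_k·2G_k ≤ BT` give LITERALLY the statement of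
  `HopTube.AheadTailWith … good n k_A BT` (CoreContract62.lean), for any `good` whose good times lie in `[0, c₀]`;
* `aheadCuts_of_step` — the cuts are produced by INDUCTION ON `j` (no simultaneous bootstrap over infinitely many
  shells, hence no `hZlow`): a base cut at `k_A + 1` and a step `cut j ⇒ cut j+1`;
* `AheadCutStepTarget … n j V G` — the ONE analytic statement behind base and step (target for the analytic lane):
  boundary bond bound `|S 1 j ·| ≤ V` on `[0, c₀]` (from the window hull at `j = k_A+1`, from the previous cut after)
  + initial tail energy `Σ_{m>j} Σ_i S₀(i,m)² ≤ G²` (AheadClause + kick ball) + the closing inequality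
  `(4/3)·c₀·clock_j·V·(V + 2εG) < G` ⇒ `AheadCutBoundWith … n j G`.  PROOF ROUTE (tree vocabulary): at `κ₁ = κ₂ = 0`,
  `B₀ = 0` the premise flow has exact energies `F = ½S²`; the tail energy `T_j(t) = Σ_{m>j} Σ_i F i m t` (summable by
  `PseudoFlowOnShift.apriori_S`) satisfies `d/dt T_j = fluxT ε ε₀ S j` (telescoping `MirrorPulse.site_energy_flux`;
  the far flux `fluxT … N → 0` by `apriori_S`, since `clock_N = (1+ε₀)^{5N/2} ≪ (1+ε₀)^{30N}`), and
  `|fluxT_j| ≤ clock_j·|v_j|·|a_{j+1}|·(|v_j| + ε|a_{j+1}|)` with `|a_{j+1}| ≤ √(2T_j)`; a scalar continuous induction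
  on `[0, c₀]` closes `√(2T_j) ≤ 2G`: `2T_j(t) ≤ G² + 4c₀·clock_j·V·G·(V + 2εG) < 4G²`;
* `cut_closing_of_max` — the closed form `G_j := max(√(2T_j(0)), 2c₀·clock_j·V_j²)` meets the (non-strict) closing
  inequality whenever `8·c₀·clock_j·V_j·ε ≤ 1` (pure algebra).

SIZES (desk, numT62/tail62.py; tube weight `2^{m²/2 + m/2}`, `r = ε₀³ = 10⁻⁹`, `ε = ½`, `c₀ = 1.8`, `k_A = 6`): initial
tails `√(2T_j(0)) ≤ 2.3e-20 (j = 7), 4.5e-23 (8), 4.4e-26 (9), …`; with the boundary bond at the window top of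
AheadClause size the flux term is below the initial tail at every cut and `BT = sup_k 4^k·2G_k = 7.6e-16`, against
`B = AFL·δ(n+1) ≥ 4.5e-8` — the flux term is QUADRATIC in the window-top hull bound `V_{k_A+1}`, which the window
enclosure must therefore export (`(4/3)c₀·clock·V² ·2·4^{k_A+1} ≤ 0.01·B` needs `V_{7} ≤ 1.3e-5` at the entry row).
The same induction with Gaussian `G_j` reproduces the AHEAD clause one shell up (the squared previous envelope is
dominated by the initial Gaussian from `j ≥ 4` on).

HONEST FRAMING: `AheadCutStepTarget` is a DESIGN (a `Prop`, not proved here); the three theorems are bookkeeping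
(composition, induction on cuts, algebra).  MODEL lattice (graded mirror table on `S♭`); nothing numerical is
asserted in Lean; nothing is certified; no item moves; nothing here is about the Navier–Stokes equations.
-/

noncomputable section

-- the sub-problem namespace repeats the summit name by design (D-0017)
set_option linter.dupNamespace false

namespace Summit.NavierStokesRegularity.NavierStokesRegularity.Theorems.HopTube

open Set Finset Literature.Analysis.FluidPDE Literature.Analysis.FluidPDE.TaoCascade MirrorPulse

section Cuts

variable (P : TubeSchedule) (Bcl : ℕ → (Fin 2 → ℤ → ℝ) → Prop) (𝕊 : Finset (ℤ × ℤ × ℤ)) (ε₀ : ℝ) (i₀ : Fin 2)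
  (α : Fin 2 → Fin 2 → Fin 2 → ℤ × ℤ × ℤ → ℝ) (X₀ : Fin 2 → ℝ) (w : ℤ → ℝ) (r c₀ : ℝ)
  (ζ : ℕ → Fin 2 → ℤ → ℝ) (ustar : Fin 2 → ℤ → ℝ)

/-- **Cut envelope.** Beyond the cut at old shell `j`, every premise flow of hop `n` stays below `2G` along the hop window
`[0, c₀]` (both species, all shells `m > j`).
[cite: Tao2016AveragedNS, §6.2 Prop. 6.3 (ix) (thin tails, statement shape); cell LADDER §62 (AHEAD-TAIL-62)] -/
def AheadCutBoundWith (n : ℕ) (j : ℤ) (G : ℝ) : Prop :=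
  ∀ z S₀ τ S F, HopPremiseWith P Bcl 𝕊 ε₀ i₀ α X₀ w r c₀ ζ ustar n z S₀ τ S F →
    ∀ t ∈ Icc 0 c₀, ∀ (i : Fin 2) (m : ℤ), j < m → |S i m t| ≤ 2 * G

/-- **THE PER-CUT STEP — target statement for the analytic lane** (see the module docstring for the proof route via the
tail energy `T_j`, `MirrorPulse.site_energy_flux` / `fluxT` and a scalar continuous induction).  Inputs: the boundary
bond bound `V` at shell `j` on `[0, c₀]`, the initial tail energy `Σ_{m>j} Σ_i S₀(i,m)² ≤ G²` (all finite partial sums),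
and the closing inequality with the mirror parameter `ε` and the clock `clock ε₀ j = (1+ε₀)^{5j/2}`.
[cite: Tao2016AveragedNS, §4 (4.3) (local energy conservation), §6.2 Prop. 6.3 (ix); cell LADDER §62 (AHEAD-TAIL-62), posited design] -/
def AheadCutStepTarget (ε : ℝ) (n : ℕ) (j : ℤ) (V G : ℝ) : Prop :=
  (∀ z S₀ τ S F, HopPremiseWith P Bcl 𝕊 ε₀ i₀ α X₀ w r c₀ ζ ustar n z S₀ τ S F →
      ∀ t ∈ Icc 0 c₀, |S 1 j t| ≤ V) →
  (∀ z S₀ τ S F, HopPremiseWith P Bcl 𝕊 ε₀ i₀ α X₀ w r c₀ ζ ustar n z S₀ τ S F →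
      ∀ N : Finset ℤ, (∀ m ∈ N, j < m) → ∑ m ∈ N, ∑ i : Fin 2, S₀ i m ^ 2 ≤ G ^ 2) →
  4 / 3 * c₀ * clock ε₀ j * V * (V + 2 * ε * G) < G →
    AheadCutBoundWith P Bcl 𝕊 ε₀ i₀ α X₀ w r c₀ ζ ustar n j G

end Cuts

section CutLemmas

variable {P : TubeSchedule} {Bcl : ℕ → (Fin 2 → ℤ → ℝ) → Prop} {𝕊 : Finset (ℤ × ℤ × ℤ)} {ε₀ : ℝ} {i₀ : Fin 2}
  {α : Fin 2 → Fin 2 → Fin 2 → ℤ × ℤ × ℤ → ℝ} {X₀ : Fin 2 → ℝ} {w : ℤ → ℝ} {r c₀ : ℝ}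
  {ζ : ℕ → Fin 2 → ℤ → ℝ} {ustar : Fin 2 → ℤ → ℝ} {n : ℕ}

/-- **CUTS ⇒ (T1).** Cut envelopes `G_k` beyond every `k > k_A` with `ω_k·2G_k ≤ BT` give the gauge tail of the flow one
shell up at every good time in `[0, c₀]` — literally the body of `HopTube.AheadTailWith … good n k_A BT`.
[cite: Tao2016AveragedNS, §6.2 Prop. 6.3 (ix) (statement shape); cell LADDER §62 (62.11 (T1))] -/
theorem aheadTail_of_cuts {good : ℕ → (Fin 2 → ℤ → ℝ → ℝ) → ℝ → Prop} {kA : ℤ} {G : ℤ → ℝ} {BT : ℝ}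
    (hg : 0 < P.g) (hb : 0 < P.b)
    (hcut : ∀ k, kA < k → AheadCutBoundWith P Bcl 𝕊 ε₀ i₀ α X₀ w r c₀ ζ ustar n k (G k))
    (hG : ∀ (i : Fin 2) (k : ℤ), kA < k → geomGauge P.g P.b i k * (2 * G k) ≤ BT)
    (hgood : ∀ z S₀ τ S F, HopPremiseWith P Bcl 𝕊 ε₀ i₀ α X₀ w r c₀ ζ ustar n z S₀ τ S F →
      ∀ t, good n S t → t ∈ Icc 0 c₀) :
    ∀ z S₀ τ S F, HopPremiseWith P Bcl 𝕊 ε₀ i₀ α X₀ w r c₀ ζ ustar n z S₀ τ S F → ∀ t, good n S t →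
      ∀ (i : Fin 2) (k : ℤ), kA < k → geomGauge P.g P.b i k * |S i (1 + k) t| ≤ BT := by
  intro z S₀ τ S F hprem t ht i k hk
  have h1 : |S i (1 + k) t| ≤ 2 * G k :=
    hcut k hk z S₀ τ S F hprem t (hgood z S₀ τ S F hprem t ht) i (1 + k) (by omega)
  exact le_trans (mul_le_mul_of_nonneg_left h1 (geomGauge_pos hg hb i k).le) (hG i k hk)

/-- **INDUCTION ON CUTS.** A base cut at `k_A + 1` and the step `cut j ⇒ cut j+1` give every cut beyond `k_A` — each an
instance of `AheadCutStepTarget` (the boundary bond bound of cut `j+1` is the envelope `2G_j` of cut `j`).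
[folklore (induction on `ℤ` from a base); cell LADDER §62 (AHEAD-TAIL-62)] -/
theorem aheadCuts_of_step {kA : ℤ} {G : ℤ → ℝ}
    (base : AheadCutBoundWith P Bcl 𝕊 ε₀ i₀ α X₀ w r c₀ ζ ustar n (kA + 1) (G (kA + 1)))
    (step : ∀ j, kA + 1 ≤ j → AheadCutBoundWith P Bcl 𝕊 ε₀ i₀ α X₀ w r c₀ ζ ustar n j (G j) →
      AheadCutBoundWith P Bcl 𝕊 ε₀ i₀ α X₀ w r c₀ ζ ustar n (j + 1) (G (j + 1))) :
    ∀ k, kA < k → AheadCutBoundWith P Bcl 𝕊 ε₀ i₀ α X₀ w r c₀ ζ ustar n k (G k) := by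
  intro k hk
  have hk' : kA + 1 ≤ k := by omega
  induction k, hk' using Int.leInduction with
  | base => exact base
  | succ k hk1 ih => exact step k hk1 (ih (by omega))

/-- **The previous cut feeds the next boundary.** The envelope of cut `j` bounds the bond at shell `j+1` on `[0, c₀]`
(the `V` input of `AheadCutStepTarget … (j+1)`). [folklore (specialisation); cell LADDER §62 (AHEAD-TAIL-62)] -/
theorem boundary_of_cut {j : ℤ} {G : ℝ}
    (h : AheadCutBoundWith P Bcl 𝕊 ε₀ i₀ α X₀ w r c₀ ζ ustar n j G) :
    ∀ z S₀ τ S F, HopPremiseWith P Bcl 𝕊 ε₀ i₀ α X₀ w r c₀ ζ ustar n z S₀ τ S F →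
      ∀ t ∈ Icc 0 c₀, |S 1 (j + 1) t| ≤ 2 * G :=
  fun z S₀ τ S F hprem t ht => h z S₀ τ S F hprem t ht 1 (j + 1) (by omega)

/-- **Closed form of the closing inequality.** `G ≥ 2c₀·clock·V²`, `8·c₀·clock·V·ε ≤ 1` and `0 ≤ G` give
`(4/3)·c₀·clock·V·(V + 2εG) ≤ G` (so `G_j := max(√(2T_j(0)), 2c₀·clock_j·V_j²)·(1+slack)` closes the step).
[folklore (linear arithmetic)] -/
theorem cut_closing_of_max {σ c V ε G : ℝ} (hG0 : 0 ≤ G)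
    (hGV : 2 * σ * c * V ^ 2 ≤ G) (hsmall : 8 * σ * c * V * ε ≤ 1) :
    4 / 3 * σ * c * V * (V + 2 * ε * G) ≤ G := by
  have h1 : 8 * σ * c * V * ε * G ≤ 1 * G := mul_le_mul_of_nonneg_right hsmall hG0
  nlinarith [h1, hGV]

end CutLemmas

/-! ## Add. 1 (62.14) — the AHEAD ZONE from the window readout and the cuts
The zone obligation `TubeStepAheadWith` is discharged by `tubeStepAheadWith_of_good` (HopTubeWithGlue) from
`∀ good t, AheadClause P w r (recentre S t a)`, i.e. `8·(w k·|S i (1+k) t / a|) ≤ r` for every new shell `k ≥ P.k₁`.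
Below: the rows `k ∈ [P.k₁, kH]` come from the WINDOW readout (ENCLOSURE-SPEC-62 E2, in the recentring-robust form
`8·(w k·|S i (1+k) t|) ≤ r·AFL` with `AFL ≤ a` a ratio floor, e.g. `1 − θ₀ε₀ ≤ clampedRatio`, CoreContract62
`one_sub_mul_le_clampedRatio`), the rows `k > kH` from the SAME cuts that feed (T1) (`aheadCuts_of_step`, base cut at
`kH + 1`), under the gauge condition `8·(w k·2G_k) ≤ r·AFL` — met by the Gaussian cut sizes
`G_k ≈ (9/8)√2·r/w_{k+1}` from `k ≥ 4` on (`16·1.59·w_k/w_{k+1} = 25.5/2^{k+1} ≤ AFL` iff `k ≥ 4`; desk tail62.py). -/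
section AheadZone

variable (P : TubeSchedule) (Bcl : ℕ → (Fin 2 → ℤ → ℝ) → Prop) (𝕊 : Finset (ℤ × ℤ × ℤ)) (ε₀ : ℝ) (i₀ : Fin 2)
  (α : Fin 2 → Fin 2 → Fin 2 → ℤ × ℤ × ℤ → ℝ) (X₀ : Fin 2 → ℝ) (w : ℤ → ℝ) (r c₀ : ℝ)
  (ζ : ℕ → Fin 2 → ℤ → ℝ) (ustar : Fin 2 → ℤ → ℝ)

/-- **Window readout, ahead rows.** At good times of hop `n`, the new shells `k ∈ [P.k₁, kH]` (old shells `1+k`, inside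
the certificate window) satisfy the AheadClause radius with the ratio floor `AFL` factored out.
[cite: Tao2016AveragedNS, §6.2 Prop. 6.3 (ix) (statement shape); cell LADDER §62 (ENCLOSURE-SPEC-62 E2), posited design] -/
def AheadWindowWith (good : ℕ → (Fin 2 → ℤ → ℝ → ℝ) → ℝ → Prop) (n : ℕ) (kH : ℤ) (AFL : ℝ) : Prop :=
  ∀ z S₀ τ S F, HopPremiseWith P Bcl 𝕊 ε₀ i₀ α X₀ w r c₀ ζ ustar n z S₀ τ S F → ∀ t, good n S t →
    ∀ (i : Fin 2) (k : ℤ), (P.k₁ : ℤ) ≤ k → k ≤ kH → 8 * (w k * |S i (1 + k) t|) ≤ r * AFL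

end AheadZone
section AheadZoneLemmas

variable {P : TubeSchedule} {Bcl : ℕ → (Fin 2 → ℤ → ℝ) → Prop} {𝕊 : Finset (ℤ × ℤ × ℤ)} {ε₀ : ℝ} {i₀ : Fin 2}
  {α : Fin 2 → Fin 2 → Fin 2 → ℤ × ℤ × ℤ → ℝ} {X₀ : Fin 2 → ℝ} {w : ℤ → ℝ} {r c₀ : ℝ}
  {ζ : ℕ → Fin 2 → ℤ → ℝ} {ustar : Fin 2 → ℤ → ℝ} {n : ℕ}

/-- **WINDOW + CUTS ⇒ the AHEAD clause of the recentred state at every good time** (the `hcl` input of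
`tubeStepAheadWith_of_good`, for any ratio `a S t ≥ AFL > 0`).
[cite: Tao2016AveragedNS, §6.2 Prop. 6.3 (ix); cell LADDER §62 (62.13 (4), 62.14)] -/
theorem aheadClause_of_window_cuts {good : ℕ → (Fin 2 → ℤ → ℝ → ℝ) → ℝ → Prop} {kH : ℤ} {AFL : ℝ} {G : ℤ → ℝ}
    {a : (Fin 2 → ℤ → ℝ → ℝ) → ℝ → ℝ}
    (hr : 0 ≤ r) (hw : ∀ k, 0 ≤ w k) (hAFL : 0 < AFL)
    (hwin : AheadWindowWith P Bcl 𝕊 ε₀ i₀ α X₀ w r c₀ ζ ustar good n kH AFL)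
    (hcut : ∀ k, kH < k → AheadCutBoundWith P Bcl 𝕊 ε₀ i₀ α X₀ w r c₀ ζ ustar n k (G k))
    (hG : ∀ k, kH < k → 8 * (w k * (2 * G k)) ≤ r * AFL)
    (hgood : ∀ z S₀ τ S F, HopPremiseWith P Bcl 𝕊 ε₀ i₀ α X₀ w r c₀ ζ ustar n z S₀ τ S F →
      ∀ t, good n S t → t ∈ Icc 0 c₀)
    (ha : ∀ z S₀ τ S F, HopPremiseWith P Bcl 𝕊 ε₀ i₀ α X₀ w r c₀ ζ ustar n z S₀ τ S F →
      ∀ t, good n S t → AFL ≤ a S t) :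
    ∀ z S₀ τ S F, HopPremiseWith P Bcl 𝕊 ε₀ i₀ α X₀ w r c₀ ζ ustar n z S₀ τ S F → ∀ t, good n S t →
      AheadClause P w r (recentre S t (a S t)) := by
  intro z S₀ τ S F h t ht i k hk
  have hapos : 0 < a S t := lt_of_lt_of_le hAFL (ha z S₀ τ S F h t ht)
  have hrow : 8 * (w k * |S i (1 + k) t|) ≤ r * AFL := by
    by_cases hkH : k ≤ kH
    · exact hwin z S₀ τ S F h t ht i k hk hkH
    · have hkH' : kH < k := not_le.mp hkH
      have hS : |S i (1 + k) t| ≤ 2 * G k := hcut k hkH' z S₀ τ S F h t (hgood z S₀ τ S F h t ht) i (1 + k) (by omega)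
      calc 8 * (w k * |S i (1 + k) t|) ≤ 8 * (w k * (2 * G k)) := by
            have := mul_le_mul_of_nonneg_left hS (hw k); linarith
        _ ≤ r * AFL := hG k hkH'
  have hrec : |recentre S t (a S t) i k| = |S i (1 + k) t| / a S t := by
    simp [recentre, abs_div, abs_of_pos hapos]
  rw [hrec]
  have h1 : 8 * (w k * (|S i (1 + k) t| / a S t)) = 8 * (w k * |S i (1 + k) t|) / a S t := by ring
  rw [h1, div_le_iff₀ hapos]
  calc 8 * (w k * |S i (1 + k) t|) ≤ r * AFL := hrow
    _ ≤ r * a S t := mul_le_mul_of_nonneg_left (ha z S₀ τ S F h t ht) hr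

end AheadZoneLemmas

end Summit.NavierStokesRegularity.NavierStokesRegularity.Theorems.HopTube
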